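import Mathlib

/-!
# The family wall `Σ_i |X_i|·|Y_i| ≤ dim J` — explicit / elementary proof (siege k18)

Route `LevelGradedCohnUmans`, crux `GradedDesignFamily` (stmt-MatrixMultiplication-7610), registered stub
`familyWall_card_le_finrank`.

For a right-translation-invariant subspace `J ≤ ℂ^G` and a family `(X_i, Y_i, Z_i)_i` (all `Z_i ≠ ∅`)
that is simultaneously `J`-separated in the 0/1 pattern of the crux, we exhibit `Σ_i |X_i|·|Y_i|`
EXPLICIT linearly independent vectors of `J` itself — no dual space, no evaluation functionals:
fix `z_i ∈ Z_i` and a separator `f_{i,x} ∈ J` for every `x ∈ X_i`; the right translates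
`w_{i,x,y} : g ↦ f_{i,x}(g · y⁻¹ z_i)` (`y ∈ Y_i`) lie in `J`, and evaluating a vanishing linear combination
`Σ c_{i,x,y} w_{i,x,y} = 0` at the single point `x₀⁻¹ y₀` (`x₀ ∈ X_a`, `y₀ ∈ Y_a`) gives
`w_{i,x,y}(x₀⁻¹ y₀) = f_{i,x}(x₀⁻¹ y₀ y⁻¹ z_i) = [a = i ∧ x₀ = x ∧ y₀ = y]` by the separation pattern, hence
`c_{a,x₀,y₀} = 0`.  So the `w`'s are linearly independent in `J` and their number is at most `dim J`.
[cite: CohnKleinbergSzegedyUmans2005, Def. 5.1]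

Mathlib only.  (The same statement was landed by the line's lead as
`…Theorems.GradedDesignFamily.familyWall_card_le_finrank` via evaluation functionals in the dual space;
this file is an independent proof in its own namespace, as required by the siege protocol.)
-/

-- single-conjunct summit: the mandated namespace repeats `MatrixMultiplication` (summit = sub-problem).
set_option linter.dupNamespace false
set_option autoImplicit false

open scoped BigOperators
open Module

namespace Summit.MatrixMultiplication.MatrixMultiplication.Theorems.GradedDesignFamily.FamilyWallK18

/-- **The family wall** (explicit form).  If `J ≤ ℂ^G` is right-translation invariant and the family
`(X_i, Y_i, Z_i)_{i : ι}` with all `Z_i` non-empty is simultaneously `J`-separated, then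
`Σ_i |X_i|·|Y_i| ≤ dim J`: the right translates `g ↦ f_{i,x}(g · y⁻¹ z_i)` of the separators are
`Σ_i |X_i|·|Y_i|` linearly independent vectors of `J`. [cite: CohnKleinbergSzegedyUmans2005, Def. 5.1] -/
theorem familyWall_card_le_finrank {G : Type} [Group G] [Fintype G] {ι : Type} [Fintype ι]
    [DecidableEq ι] (J : Submodule ℂ (G → ℂ)) (hJ : ∀ f ∈ J, ∀ u : G, (fun g : G => f (g * u)) ∈ J)
    (X Y Z : ι → Finset G) (hZ : ∀ i, (Z i).Nonempty)
    (hsep : ∀ i : ι, ∀ x₀ ∈ X i, ∀ z₀ ∈ Z i, ∃ f ∈ J, ∀ a b : ι, ∀ x ∈ X a, ∀ y ∈ Y a, ∀ y' ∈ Y b,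
      ∀ z ∈ Z b, ((a = i ∧ b = i ∧ x = x₀ ∧ y = y' ∧ z = z₀) → f (x⁻¹ * y * y'⁻¹ * z) = 1) ∧
        (¬ (a = i ∧ b = i ∧ x = x₀ ∧ y = y' ∧ z = z₀) → f (x⁻¹ * y * y'⁻¹ * z) = 0)) :
    ∑ i, (X i).card * (Y i).card ≤ finrank ℂ J := by
  classical
  -- Step 1: fix one point `zc i ∈ Z i` in every block.
  choose zc hzc using hZ
  -- Step 2: fix a separator `sep i x ∈ J` for every `x ∈ X i` (with respect to `zc i`).
  have hsep' : ∀ i : ι, ∀ x₀ ∈ X i, ∃ f ∈ J, ∀ a b : ι, ∀ x ∈ X a, ∀ y ∈ Y a, ∀ y' ∈ Y b,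
      ∀ z ∈ Z b, ((a = i ∧ b = i ∧ x = x₀ ∧ y = y' ∧ z = zc i) → f (x⁻¹ * y * y'⁻¹ * z) = 1) ∧
        (¬ (a = i ∧ b = i ∧ x = x₀ ∧ y = y' ∧ z = zc i) → f (x⁻¹ * y * y'⁻¹ * z) = 0) :=
    fun i x₀ hx₀ => hsep i x₀ hx₀ (zc i) (hzc i)
  choose! sep hsepJ hsepv using hsep'
  -- Step 3: the index set `S = Σ_i X_i × Y_i` and the explicit vectors `w s ∈ J`
  -- (right translates `g ↦ sep i x (g * (y⁻¹ * zc i))` of the separators).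
  let S : Type := Σ i : ι, ↥(X i ×ˢ Y i)
  have hXmem : ∀ s : S, (s.2 : G × G).1 ∈ X s.1 := fun s => (Finset.mem_product.mp s.2.2).1
  have hYmem : ∀ s : S, (s.2 : G × G).2 ∈ Y s.1 := fun s => (Finset.mem_product.mp s.2.2).2
  let w : S → J := fun s =>
    ⟨fun g : G => sep s.1 (s.2 : G × G).1 (g * (((s.2 : G × G).2)⁻¹ * zc s.1)),
      hJ _ (hsepJ s.1 _ (hXmem s)) _⟩
  -- Step 4: the value of `w s` at a point `x₀⁻¹ y₀` of block `a` is the Kronecker delta `[s = (a,x₀,y₀)]`.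
  have hval : ∀ (s : S) (a : ι) (x₀ y₀ : G) (hp : (x₀, y₀) ∈ X a ×ˢ Y a),
      (w s : G → ℂ) (x₀⁻¹ * y₀) = if s = ⟨a, ⟨(x₀, y₀), hp⟩⟩ then 1 else 0 := by
    rintro ⟨b, ⟨⟨x, y⟩, hq⟩⟩ a x₀ y₀ hp
    obtain ⟨hx₀, hy₀⟩ := Finset.mem_product.mp hp
    obtain ⟨hx, hy⟩ := Finset.mem_product.mp hq
    obtain ⟨h1, h0⟩ := hsepv b x hx a b x₀ hx₀ y₀ hy₀ y hy (zc b) (hzc b)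
    have hassoc : x₀⁻¹ * y₀ * (y⁻¹ * zc b) = x₀⁻¹ * y₀ * y⁻¹ * zc b := by group
    show sep b x (x₀⁻¹ * y₀ * (y⁻¹ * zc b)) = _
    rw [hassoc]
    by_cases hs : (⟨b, ⟨(x, y), hq⟩⟩ : S) = ⟨a, ⟨(x₀, y₀), hp⟩⟩
    · rw [if_pos hs]
      obtain ⟨rfl, h2⟩ := Sigma.mk.inj_iff.mp hs
      have h2' := Subtype.ext_iff.mp (eq_of_heq h2)
      simp only [Prod.mk.injEq] at h2'
      obtain ⟨rfl, rfl⟩ := h2'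
      exact h1 ⟨rfl, rfl, rfl, rfl, rfl⟩
    · rw [if_neg hs]
      refine h0 ?_
      rintro ⟨rfl, -, rfl, rfl, -⟩
      exact hs rfl
  -- Step 5: linear independence of `w` in `J`, by evaluating a relation at the points `x₀⁻¹ y₀`.
  have hlin : LinearIndependent ℂ w := by
    rw [Fintype.linearIndependent_iff]
    intro c hrel s₀
    obtain ⟨a, ⟨⟨x₀, y₀⟩, hp⟩⟩ := s₀
    have key := congrArg (fun f : J => (f : G → ℂ) (x₀⁻¹ * y₀)) hrel
    simp only [Submodule.coe_sum, Submodule.coe_smul, Finset.sum_apply, Pi.smul_apply, smul_eq_mul,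
      ZeroMemClass.coe_zero, Pi.zero_apply] at key
    have hterm : ∀ s ∈ (Finset.univ : Finset S),
        c s * (w s : G → ℂ) (x₀⁻¹ * y₀) = if s = ⟨a, ⟨(x₀, y₀), hp⟩⟩ then c s else 0 := by
      intro s _
      rw [hval s a x₀ y₀ hp]
      split_ifs <;> simp
    rw [Finset.sum_congr rfl hterm, Finset.sum_ite_eq' Finset.univ, if_pos (Finset.mem_univ _)] at key
    exact key
  -- Step 6: count.
  have hcard : Fintype.card S = ∑ i, (X i).card * (Y i).card := by
    simp only [S, Fintype.card_sigma, Fintype.card_coe, Finset.card_product]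
  haveI : FiniteDimensional ℂ J := inferInstance
  calc ∑ i, (X i).card * (Y i).card = Fintype.card S := hcard.symm
    _ ≤ finrank ℂ J := hlin.fintype_card_le_finrank

end Summit.MatrixMultiplication.MatrixMultiplication.Theorems.GradedDesignFamily.FamilyWallK18
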